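import Mathlib
import Summits.Ventures.HodgeRepro.Tier4.Common.AdelicDefs
import Summits.Ventures.HodgeRepro.Tier4.Line1.PlaneDefs
import Summits.Ventures.HodgeRepro.Tier4.Line1.LinRegular
import Summits.Ventures.HodgeRepro.Tier4.Line4.LineScalars
import Summits.Ventures.HodgeRepro.Tier4.Line4.OrbitBlocks
import Summits.Ventures.HodgeRepro.Tier4.Line4.RationalLineScalars
import Summits.Ventures.HodgeRepro.Tier4.Line4.RowLineCoords
import Summits.Ventures.HodgeRepro.Tier4.Line4.OrbitFibre

/-!
# Tier4/Line4/LinRegularBlocks — linear regularity forces all four blocks `P_i g Q_j` (and the block scalars) to be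
non-zero, on ANY genuine plane with non-degenerate `B`

Blind re-derivation cell `pub-hodge-repro`, Tier 4 (README §9–§10), seat t4-L2-p3 (gen 5).  Tree path
`lean/Summits/Ventures/HodgeRepro/Tier4/Line4/LinRegularBlocks.lean`.  The GENERAL-PLANE form of the bridge
«`IsLinRegular γ ⇒ coordinate hreg`» (L2-p3 g4's (a) of S15168): the row-plane instance in OrbitInvariantFibre's
coordinates is L1-p3's `hreg_of_isLinRegular` (Tier4/Line4/LinRegularCoords, p708292, of record); this module is the
SUPPORT of P2 (`Tier4/Line4/LevelCongruence`, the `q`-adic congruence at `γ₀`, plan-4 S15514), which reads the four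
rational blocks `P_i g₀ Q_j ≠ 0` of a linearly regular `γ₀` on the plane of the glue.

* `inv_mul_B_eq_B_mul_transpose`: for a unitary `g` with inverse `h`, `h B = B gᵀ`;
* `Q_mul_inv_mul_P_eq_zero_of_block_eq_zero`: if the block `P_i g Q_j` vanishes then so does `Q_j g⁻¹ P_i`
  (`B` non-degenerate, `P_i`, `Q_j` `B`-self-adjoint);
* `conj_comm_Q_of_block_eq_zero`: a vanishing block makes `g⁻¹ P_i g` commute with both `Q`-projectors;
* **`P_mul_mul_Q_ne_zero_of_isLinRegular`** (`'`: under `IsGenuineRow`): for a linearly regular rational point NO block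
  `P_i g Q_j` vanishes — the pair `Y = P_i`, `Y′ = g⁻¹ P_i g` would be a commutant pair with `Y γ = γ Y′`, hence an
  `E′_𝔸`-scalar by `IsLinRegular`, against `not_scalar_of_complementary` (rank `2`);
* **`coords_ne_zero_of_isLinRegular`**: in row coordinates `(w_i g) Q_j = v_j · escK (x_ij, y_ij)`, all four
  `(x_ij, y_ij) ≠ (0, 0)` — the `hreg` binder of OrbitFibre's `orbitOf_eq_of_scalar_nrm_eq` on any plane.

The other bridge, `IsLinRegular → IsRegularRational`, is L1-p3's `Line1.isRegularRational_of_isLinRegular`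
(Tier4/Line1/DefinedContentOfData), consumed by name.  No printed input is consumed.  HC_CM is NOT proved by anyone in
this repository.
-/

set_option autoImplicit false

noncomputable section

namespace Summit.Ventures.HodgeRepro.Tier4.Line4

open Summit.Ventures.HodgeRepro.Tier4 Summit.Ventures.HodgeRepro.Tier4.Common
  Summit.Ventures.HodgeRepro.Tier4.Line1 Matrix

variable {k : Type} [Field k] (W : PlaneData k)

/-! ### 1. Matrix identities of a rational unitary -/

/-- For a unitary `g` (`g B gᵀ = B`) with left inverse `h` (`h g = 1`): `h B = B gᵀ`. -/
theorem inv_mul_B_eq_B_mul_transpose {g h : Matrix (Fin 4) (Fin 4) k} (hhg : h * g = 1)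
    (hgB : g * W.B * gᵀ = W.B) : h * W.B = W.B * gᵀ := by
  calc h * W.B = h * (g * W.B * gᵀ) := by rw [hgB]
    _ = (h * g) * W.B * gᵀ := by simp only [Matrix.mul_assoc]
    _ = W.B * gᵀ := by rw [hhg, Matrix.one_mul]

/-- **A vanishing block is symmetric**: if `P_i g Q_j = 0` for a unitary `g` with inverse `h`, then `Q_j h P_i = 0`
(`B` non-degenerate, `P_i`, `Q_j` `B`-self-adjoint): `Q_j h P_i B = Q_j h B P_iᵀ = Q_j B gᵀ P_iᵀ = B (P_i g Q_j)ᵀ`. -/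
theorem Q_mul_inv_mul_P_eq_zero_of_block_eq_zero (hB : W.B.det ≠ 0)
    (hPB : ∀ i, W.P i * W.B = W.B * (W.P i)ᵀ) (hQB : ∀ j, W.Q j * W.B = W.B * (W.Q j)ᵀ)
    {g h : Matrix (Fin 4) (Fin 4) k} (hhg : h * g = 1) (hgB : g * W.B * gᵀ = W.B) {i j : Fin 2}
    (h0 : W.P i * g * W.Q j = 0) : W.Q j * h * W.P i = 0 := by
  have hhB := inv_mul_B_eq_B_mul_transpose W hhg hgB
  have key : W.Q j * h * W.P i * W.B = 0 := by
    calc W.Q j * h * W.P i * W.B = W.Q j * h * (W.P i * W.B) := by simp only [Matrix.mul_assoc]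
      _ = W.Q j * (h * W.B) * (W.P i)ᵀ := by rw [hPB i]; simp only [Matrix.mul_assoc]
      _ = (W.Q j * W.B) * gᵀ * (W.P i)ᵀ := by rw [hhB]; simp only [Matrix.mul_assoc]
      _ = W.B * ((W.Q j)ᵀ * gᵀ * (W.P i)ᵀ) := by rw [hQB j]; simp only [Matrix.mul_assoc]
      _ = W.B * (W.P i * g * W.Q j)ᵀ := by rw [Matrix.transpose_mul, Matrix.transpose_mul]; simp only [Matrix.mul_assoc]
      _ = 0 := by rw [h0, Matrix.transpose_zero, Matrix.mul_zero]
  have hunit : IsUnit W.B.det := isUnit_iff_ne_zero.2 hB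
  calc W.Q j * h * W.P i = W.Q j * h * W.P i * W.B * W.B⁻¹ := by
        rw [Matrix.mul_assoc (W.Q j * h * W.P i), Matrix.mul_nonsing_inv _ hunit, Matrix.mul_one]
    _ = 0 := by rw [key, Matrix.zero_mul]

/-- `Q_{j'} = 1 − Q_j` for `j' ≠ j`. -/
theorem Q_eq_one_sub_of_ne {j j' : Fin 2} (hne : j' ≠ j) : W.Q j' = 1 - W.Q j := by
  fin_cases j <;> fin_cases j'
  · exact absurd rfl hne
  · show W.Q 1 = 1 - W.Q 0
    rw [← W.Q_sum]; abel
  · show W.Q 0 = 1 - W.Q 1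
    rw [← W.Q_sum]; abel
  · exact absurd rfl hne

/-- **A vanishing block makes `g⁻¹ P_i g` commute with both `Q`-projectors**: from `P_i g Q_j = 0` and
`Q_j h P_i = 0` (`h = g⁻¹`), `X := h P_i g` satisfies `X Q_j = 0 = Q_j X` and `X Q_{j'} = X = Q_{j'} X` for the
other index. -/
theorem conj_comm_Q_of_block_eq_zero {g h : Matrix (Fin 4) (Fin 4) k} {i j : Fin 2}
    (h0 : W.P i * g * W.Q j = 0) (h0' : W.Q j * h * W.P i = 0) (j' : Fin 2) :
    h * W.P i * g * W.Q j' = W.Q j' * (h * W.P i * g) := by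
  have hXQ : h * W.P i * g * W.Q j = 0 := by
    rw [Matrix.mul_assoc, Matrix.mul_assoc, ← Matrix.mul_assoc (W.P i), h0, Matrix.mul_zero]
  have hQX : W.Q j * (h * W.P i * g) = 0 := by
    rw [← Matrix.mul_assoc, ← Matrix.mul_assoc, h0', Matrix.zero_mul]
  by_cases hjj : j' = j
  · rw [hjj, hXQ, hQX]
  · rw [Q_eq_one_sub_of_ne W hjj, Matrix.mul_sub, Matrix.sub_mul, Matrix.mul_one, Matrix.one_mul, hXQ, hQX]

/-! ### 2. No block of a linearly regular rational point vanishes -/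

variable [NumberField k]

/-- **THE BRIDGE, matrix form** (C-L4-LINREG-COORD): for a plane with `Ω² = −d` (`−d` not a square), `B`-self-adjoint
projectors of rank `2` on the `P`-side and non-degenerate `B`, a LINEARLY REGULAR rational point `γ` with rational
matrix `g` has all four blocks `P_i g Q_j` non-zero.  A vanishing block would make `Y := P_i`, `Y′ := g⁻¹ P_i g` a pair
of adelic matrices in the two commutants with `Y γ = γ Y′`, which `IsLinRegular` makes an `E′_𝔸`-scalar — but a
rank-`2` complementary projector is not a scalar (`not_scalar_of_complementary`). -/
theorem P_mul_mul_Q_ne_zero_of_isLinRegular {d : k} (hΩ : W.Ω * W.Ω = -(d • (1 : Matrix (Fin 4) (Fin 4) k)))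
    (hd : ¬ IsSquare (-d)) (hPB : ∀ i, W.P i * W.B = W.B * (W.P i)ᵀ)
    (hQB : ∀ j, W.Q j * W.B = W.B * (W.Q j)ᵀ) (hPr : ∀ i, (W.P i).rank = 2) (hB : W.B.det ≠ 0)
    (γ : rationalPoints W) (hreg : IsLinRegular W γ) {g : Matrix (Fin 4) (Fin 4) k}
    (hg : adMat k g = GA.mat W (γ : GA W)) (i j : Fin 2) : W.P i * g * W.Q j ≠ 0 := by
  intro h0
  obtain ⟨hgΩ, hgB⟩ := rational_mat_props W hg
  have hdet : IsUnit g.det := isUnit_iff_ne_zero.2 (det_ne_zero_of_adMat_eq_mat W (γ : GA W) hg)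
  set h : Matrix (Fin 4) (Fin 4) k := g⁻¹ with hh
  have hhg : h * g = 1 := Matrix.nonsing_inv_mul g hdet
  have hgh : g * h = 1 := Matrix.mul_nonsing_inv g hdet
  have hhΩ : h * W.Ω = W.Ω * h := by
    calc h * W.Ω = h * W.Ω * (g * h) := by rw [hgh, Matrix.mul_one]
      _ = h * (W.Ω * g) * h := by simp only [Matrix.mul_assoc]
      _ = h * (g * W.Ω) * h := by rw [hgΩ]
      _ = W.Ω * h := by rw [← Matrix.mul_assoc, hhg, Matrix.one_mul]
  have h0' := Q_mul_inv_mul_P_eq_zero_of_block_eq_zero W hB hPB hQB hhg hgB h0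
  set X : Matrix (Fin 4) (Fin 4) k := h * W.P i * g with hX
  have hXΩ : X * W.Ω = W.Ω * X := by
    calc X * W.Ω = h * W.P i * (g * W.Ω) := by rw [hX]; simp only [Matrix.mul_assoc]
      _ = h * (W.P i * W.Ω) * g := by rw [hgΩ]; simp only [Matrix.mul_assoc]
      _ = (h * W.Ω) * W.P i * g := by rw [W.P_comm i]; simp only [Matrix.mul_assoc]
      _ = W.Ω * X := by rw [hhΩ, hX]; simp only [Matrix.mul_assoc]
  have hXQ : ∀ j', X * W.Q j' = W.Q j' * X := fun j' => conj_comm_Q_of_block_eq_zero W h0 h0' j'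
  -- the commutant data for `IsLinRegular`
  have h1 : adMat k (W.P i) * adMat k W.Ω = adMat k W.Ω * adMat k (W.P i) := by
    rw [← adMat_mul, ← adMat_mul, W.P_comm i]
  have h2 : ∀ i', adMat k (W.P i) * adMat k (W.P i') = adMat k (W.P i') * adMat k (W.P i) := by
    intro i'
    rw [← adMat_mul, ← adMat_mul]
    by_cases hii : i = i'
    · rw [hii]
    · rw [mul_eq_zero_of_ne W.P W.P_idem W.P_sum hii, mul_eq_zero_of_ne W.P W.P_idem W.P_sum (Ne.symm hii)]
  have h3 : adMat k X * adMat k W.Ω = adMat k W.Ω * adMat k X := by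
    rw [← adMat_mul, ← adMat_mul, hXΩ]
  have h4 : ∀ j', adMat k X * adMat k (W.Q j') = adMat k (W.Q j') * adMat k X := by
    intro j'
    rw [← adMat_mul, ← adMat_mul, hXQ j']
  have h5 : adMat k (W.P i) * GA.mat W (γ : GA W) = GA.mat W (γ : GA W) * adMat k X := by
    rw [← hg, ← adMat_mul, ← adMat_mul, hX]
    congr 1
    calc W.P i * g = (g * h) * W.P i * g := by rw [hgh, Matrix.one_mul]
      _ = g * (h * W.P i * g) := by simp only [Matrix.mul_assoc]
  obtain ⟨x, y, hx, -⟩ := hreg (adMat k (W.P i)) (adMat k X) h1 h2 h3 h4 h5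
  exact not_scalar_of_complementary W hΩ hd W.P W.P_idem hPr W.P_sum i x y hx

/-! ### 3. The row-coordinate form: all four block scalars are non-zero -/

/-- **THE BRIDGE, row-coordinate form** (`hreg` of OrbitFibre's `orbitOf_eq_of_scalar_nrm_eq`): with rows `w_i`
spanning the `P`-lines (`w_i P_i = w_i`, `w_i ≠ 0`) and the block scalars `(w_i g) Q_j = v_j · escK (x_ij, y_ij)`, a
linearly regular rational `γ` has `(x_ij, y_ij) ≠ (0, 0)` for all four `(i, j)`: a vanishing scalar gives
`(w_i g) Q_j = 0`, hence (the `P_i`-line being spanned by `w_i, w_i Ω`) `P_i g Q_j = 0`. -/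
theorem coords_ne_zero_of_isLinRegular {d : k} (hΩ : W.Ω * W.Ω = -(d • (1 : Matrix (Fin 4) (Fin 4) k)))
    (hd : ¬ IsSquare (-d)) (hPB : ∀ i, W.P i * W.B = W.B * (W.P i)ᵀ)
    (hQB : ∀ j, W.Q j * W.B = W.B * (W.Q j)ᵀ) (hPr : ∀ i, (W.P i).rank = 2) (hB : W.B.det ≠ 0)
    (γ : rationalPoints W) (hreg : IsLinRegular W γ) {g : Matrix (Fin 4) (Fin 4) k}
    (hg : adMat k g = GA.mat W (γ : GA W)) {w : Fin 2 → Fin 4 → k} (hw : ∀ i, w i ᵥ* W.P i = w i)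
    (hw0 : ∀ i, w i ≠ 0) {v : Fin 2 → Fin 4 → k} {x y : Fin 2 → Fin 2 → k}
    (hxy : ∀ i j, (w i ᵥ* g) ᵥ* W.Q j = v j ᵥ* escK W (x i j) (y i j)) (i j : Fin 2) :
    ¬ (x i j = 0 ∧ y i j = 0) := by
  rintro ⟨hx, hy⟩
  have hgΩ := (rational_mat_props W hg).1
  -- the row `w_i g Q_j` vanishes
  have hrow : (w i ᵥ* g) ᵥ* W.Q j = 0 := by
    rw [hxy i j, hx, hy]
    simp [escK]
  -- so does `(w_i Ω) g Q_j = (w_i g Q_j) Ω`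
  have hrowΩ : ((w i ᵥ* W.Ω) ᵥ* g) ᵥ* W.Q j = 0 := by
    have hcomm : W.Ω * (g * W.Q j) = g * W.Q j * W.Ω := by
      rw [← Matrix.mul_assoc, ← hgΩ, Matrix.mul_assoc, ← W.Q_comm j, Matrix.mul_assoc]
    rw [vecMul_vecMul, vecMul_vecMul, hcomm, ← vecMul_vecMul, ← vecMul_vecMul, hrow, zero_vecMul]
  -- every row of the `P_i`-line is a combination of `w_i`, `w_i Ω`
  have hspan := row_range_le_span_pair W hΩ hd (W.P_comm i) (hPr i) (hw0 i) (hw i)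
  have hall : ∀ u : Fin 4 → k, (u ᵥ* W.P i) ᵥ* g ᵥ* W.Q j = 0 := by
    intro u
    have hmem : u ᵥ* W.P i ∈ LinearMap.range (W.P i)ᵀ.mulVecLin := ⟨u, by simp⟩
    obtain ⟨a, b, hab⟩ := Submodule.mem_span_pair.1 (hspan hmem)
    rw [← hab, add_vecMul, smul_vecMul, smul_vecMul, add_vecMul, smul_vecMul, smul_vecMul, hrow, hrowΩ,
      smul_zero, smul_zero, add_zero]
  apply P_mul_mul_Q_ne_zero_of_isLinRegular W hΩ hd hPB hQB hPr hB γ hreg hg i j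
  ext a b
  have h := congrFun (hall (Pi.single a 1)) b
  simp only [vecMul_vecMul, Pi.zero_apply] at h
  rw [single_one_vecMul] at h
  exact h

/-- The same under the line's predicate `IsGenuineRow` (conjuncts 1, 3, 4, 5 used) and non-degenerate `B`. -/
theorem P_mul_mul_Q_ne_zero_of_isLinRegular' (hgen : IsGenuineRow W) (hB : W.B.det ≠ 0)
    (γ : rationalPoints W) (hreg : IsLinRegular W γ) {g : Matrix (Fin 4) (Fin 4) k}
    (hg : adMat k g = GA.mat W (γ : GA W)) (i j : Fin 2) : W.P i * g * W.Q j ≠ 0 := by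
  obtain ⟨⟨d, hΩ, hd⟩, -, hPB, hQB, hPr, -⟩ := hgen
  exact P_mul_mul_Q_ne_zero_of_isLinRegular W hΩ hd hPB hQB hPr hB γ hreg hg i j


end Summit.Ventures.HodgeRepro.Tier4.Line4

end
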